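/-
Copyright (c) 2026 the pub-hodgecm-mathlib formalisation cell (harness21).  Prover seat hodgecm-mathlib-K2E5-p17 (g9), Track B «K2-LIT»,
#184♮ = hLiu418 = `stmt-HodgeConjecture-24832`; socket #41 — THE TOP, edition 16 «KIND 1 AT THE LETTERS OF RECORD»: edition 15 with the KIND-1 block replaced by the two
ONE-FUNCTION packages K1-b♮ ∕ K1-a♮ of ★ p862409 `K2LiuKindOneLettersOfRecord` (pin at THIS carrier, holomorphy, (L-dec), (L-supp)); the weights are ★ p862451
(author of record by lineage, LEAD F0P6-plan (g14) BATCH #46 (a) ∕ #49 ∕ #66 (6)).  THEOREMS ONLY; NO `Lines` import.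
-/
import Summits.HodgeConjecture.HodgeConjecture.Theorems.K2LiuSiegelEisensteinConstantTermFiniteness        -- ★ ed. 4a′ (this seat) ⊇ ed. 4a ⊇ ed. 3b
import Summits.HodgeConjecture.HodgeConjecture.Theorems.K2LiuSiegelEisensteinKindZeroBigCellLetters         -- ★ p861499 `standardFamily_growth`
import Summits.HodgeConjecture.HodgeConjecture.Theorems.K2LiuSiegelEisensteinBigCellTermPackageCM          -- ★ p861474 `exists_bigCell_termPackage_cm` (P₈ = {½}, scalar b^S∕a^S)
import Summits.HodgeConjecture.HodgeConjecture.Theorems.K2LiuKindOneLettersOfRecord                        -- ★ p862409 `exists_kindOne_sixLetters_of_record` (KIND 1 at the letters of record, F0P2-p11)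
import Summits.HodgeConjecture.HodgeConjecture.Theorems.K2LiuKindOneWeightsOfDecay                         -- ★ p862451 `kindOne_weight_of_decay` (KIND-1 weights from (L-dec) + (L-supp), F0P2-p11 over ★ p862095)
import Summits.HodgeConjecture.HodgeConjecture.Theorems.K2LiuFourierCoeffDeltaContinuous                 -- ★ p861715 `continuous_fourierCoeffDelta_eisenstein{Series,Family}Delta` (`hRKc` paid)
import Summits.HodgeConjecture.HodgeConjecture.Theorems.K2LiuSiegelEisensteinCoeffNondegenerateCurve      -- ★ Φ2 `fourierCoeffDelta_eisensteinFamilyDelta_eq_curve` (`E_S = (∫β)⁻¹·W_S`, `det S ≠ 0`)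
import Summits.HodgeConjecture.HodgeConjecture.Theorems.K2LiuSiegelEisensteinMiddleTermContinuous          -- ★ p861968 `exists_middleTerm_package'` (I4 ED. 2: carriers, idele class domain, `hMIDc` inside; K2E4-p11)
import Summits.HodgeConjecture.HodgeConjecture.Theorems.K2LiuSiegelEisensteinWhittakerFactorLetters        -- ★ p862137 `exists_whittaker_factorLetters_of_weightLetters` (KIND W ED. 2, F0P2-p08 ∘ K2E4-p10 ★ p862095)
import Summits.HodgeConjecture.HodgeConjecture.Theorems.K2LiuBigCellContinuationOfFacesSum                  -- ★ p862134 `exists_bigCell_continuation_cm_of_facesSum` ((β) summed faces → continuation, K2Liu-p13; head of record)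
import Summits.HodgeConjecture.HodgeConjecture.Theorems.K2LiuSiegelEisensteinWhittakerTermPackageFixedCarrier  -- ★ p861446 `exists_whittaker_packages_fourierCoeff_fixedCarrier`
import Summits.HodgeConjecture.HodgeConjecture.Theorems.K2LiuSiegelEisensteinWhittakerMajorant              -- ★ p861512 `whittaker_majorant∕summedGrowth_of_weightedGrowth`
import HarnessLib

/-!
# Crux `HLiu418`, socket #41 — THE TOP, edition 16 «KIND 1 AT THE LETTERS OF RECORD»: edition 15 with the KIND-1 binder block (★ p861664's 25 letters
# `ι a had ρb ρa G hρb hG hGρ Eb Ea hEb hEa ua ub uG hua hub huG N₀ hN₀ hag hbg haG hws₁ hRK₁`) REPLACED by two ONE-FUNCTION packages pinned at THIS carrier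

Cell `hodgecm-mathlib`, crux item hLiu418 = `stmt-HodgeConjecture-24832` (helper lane until the typist's tie; count-neutral).

THE KIND-1 LETTERS OF RECORD (★ p862409 `K2LiuKindOneLettersOfRecord`, F0P2-p11; desk 2026-09-04T22:05Z∕22:12Z).  In the term data of ★ ed. 3b ∕ ★ p861664 take `ι := fun _ => Unit`,
`a := 1`, `ρb := 1`, `ρa S s := (s − ½)⁻¹`, `G := 1`, `Eb S _ := Ebc S`, `Ea S _ := Eac S`: KIND 1 is then TWO FUNCTIONS `Ebc, Eac : Skew → ℂ → H(𝔸) → ℂ` — the continued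
NORMALISED MIDDLE-CELL (line) term and the continued `(s − ½)·`NORMALISED WHITTAKER (singular) term of a rank-one index (`S ≠ 0`, `det S = 0`) — and about EACH of them FOUR letters:
holomorphy on `{0 < re s}`; the PIN on `{n∕2 < re s}` at THIS carrier `(νN, β ≤ 𝟙_K)` (`Ebc S s h = (∫β)⁻¹ • MID_S(νN, β, f_s, h)` with O41.4's rational Weyl presentation `wq`,
`Eac S s h = (s − ½)·((∫β)⁻¹ • W_S(νN)(f_s)(h))`); (L-dec) height-form Gaussian decay near every `z` (`0 < re z`) in an archimedean size `τ(S) ≥` the sup-norm of the mixed embedding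
of the entries of `S` (one size function per term); (L-supp) bounded-denominator support on `{0 < re s}`.  INSIDE, BY NAME: the summable weights `(ub, hub, hbg)`, `(uG, huG, haG)` from
(L-dec) + (L-supp) (★ p862451 `kindOne_weight_of_decay`, twice; `hws := Summable.add`), then ★ p862409 §4 `exists_kindOne_sixLetters_of_record` AT THIS CARRIER ⇒ the six kind-1 letters
`(Ec₁, h1off, hd₁, hc₁, hcoef₁, hmaj₁, hgr₁)` of ★ ed. 3b (the identification `hRK₁` at every carrier is ★ p862409 §3 by Haar uniqueness + ★ Φ1∕Φ2 carrier transport; `hRKc` ★ p861715).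
Everything else as edition 15: KIND 0 big cell = ★ p862134 SUMMED FACES by value `(P₈ hPS I₈ TF q hq A₈ hA₈ c₈ hc₈ N₈ hN₈ hB)` → ★ p861474; middle = ★ p861968 I4 ED. 2 letters by value;
identity cell ★ p861499; O41.4 ★ ed. 4a′; KIND-0 assembly ★ ed. 4a; KIND W = ★ p862137 letters `(A U hEuler hAd τ hτ NW hdec hCW hκ hsupp)` by value → ★ p861446 ∕ ★ p861512; `P = {½}`.
WHAT REMAINS BY VALUE (the named surface of record after this edition): `(wq, hwq)`; `{S} hS hur`; the (β) faces block; the I4 middle block; K1-b♮ `(Ebc hEbd hEbc τb hτb Nb hdecb hCb hκb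
hsuppb)`; K1-a♮ `(Eac hEad hEac τa hτa Na hdeca hCa hκa hsuppa)`; the KIND-W block.
HEAD **`siegelEisensteinContinuation_sixteen`** ⇒ socket #41's body BYTES VERBATIM (via ★ ed. 3b `siegelEisensteinContinuation_of_kinds_fixedCarrier` at `P := {½}`).
Sources: [Tan1999, §1 Main Theorem; §4 Props. 4.1, 4.4, 4.8]; [MoeglinWaldspurger1995, I.2.6, II.1.7, IV.1.8–IV.1.11]; [KudlaRallis1994, §1–§2]; [Shimura1997, §18.4, Prop. 18.14];
[Liu2021, Lem. B.10 (2), B.12].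
HONEST LABEL.  Count-neutral helper until tied; `HC_CM` is proved only modulo the 7 printed citations (2 remaining named inputs: hLiu418 = `stmt-HodgeConjecture-24832`,
h413 = `stmt-HodgeConjecture-24833`) until rung 0 closes.
-/

set_option autoImplicit false
set_option linter.dupNamespace false -- the mandated namespace repeats `HodgeConjecture.HodgeConjecture`

noncomputable section

open scoped Matrix Topology ENNReal NNReal BigOperators ComplexConjugate
open NumberField IsDedekindDomain MeasureTheory Filter
open Literature.NumberTheory.Automorphic Literature.NumberTheory.GaloisRepresentations
open Literature.NumberTheory.GelbartRogawski1991 Literature.NumberTheory.GelbartRogawski1991.GRConstruction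
open Literature.NumberTheory.K2Lit.SiegelDoubled Literature.MeasureTheory.Group
open Literature.NumberTheory.Automorphic.IdeleClassGroup

namespace Summit.HodgeConjecture.HodgeConjecture.Cruxes.HLiu418.K2LiuSiegelEisensteinContinuationTopSixteen

open K2LiuSiegelUnipotentFourierDefs K2LiuSiegelEisensteinContinuationTopKinds K2LiuSiegelEisensteinConstantTermPackage K2LiuSiegelEisensteinConstantTermFiniteness
open K2LiuSiegelEisensteinKindZeroBigCellLetters (standardFamily_growth)
open K2LiuSiegelEisensteinBigCellTermPackageCM (exists_bigCell_termPackage_cm)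
open K2LiuKindOneLettersOfRecord (exists_kindOne_sixLetters_of_record)
open K2LiuKindOneWeightsOfDecay (kindOne_weight_of_decay)
open K2LiuFourierCoeffDeltaContinuous (continuous_fourierCoeffDelta_eisensteinSeriesDelta)
open K2LiuSiegelEisensteinCoeffNondegenerateCurve (fourierCoeffDelta_eisensteinFamilyDelta_eq_curve)
open K2LiuSiegelEisensteinMiddleTermContinuous (exists_middleTerm_package')
open K2LiuSiegelEisensteinWhittakerFactorLetters (exists_whittaker_factorLetters_of_weightLetters)
open K2LiuBigCellContinuationOfFacesSum (exists_bigCell_continuation_cm_of_facesSum)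
open K2LiuQRationalDefs (IsQRationalRegularAt)
open K2LiuGL2FlatSectionFiniteData (ofFinite_mem)
open K2LiuSiegelEisensteinWhittakerTermPackageFixedCarrier (exists_whittaker_packages_fourierCoeff_fixedCarrier)
open K2LiuSiegelEisensteinWhittakerMajorant (whittaker_majorant_of_weightedGrowth whittaker_summedGrowth_of_weightedGrowth)

open Classical in
/-- **SOCKET #41, KIND 1 AT THE LETTERS OF RECORD (edition 16).**  Edition 15 with the KIND-1 block replaced by the two ONE-FUNCTION packages of ★ p862409: K1-b♮ — the
continued normalised middle-cell (line) term `Ebc` with holomorphy `hEbd` on `{0 < re}`, the PIN `hEbc` at THIS carrier `(νN, β)` on `{n∕2 < re s}` for rank-one `S`, height-form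
Gaussian decay `hdecb` in a size `τb ≥ ‖S‖_∞` and bounded-denominator support `hsuppb`; K1-a♮ — the continued `(s − ½)·`normalised Whittaker term `Eac` with `hEad`, the PIN `hEac`,
`hdeca` in `τa`, `hsuppa`.  Inside: weights ★ p862451 (twice), six letters ★ p862409 §4 at this carrier (`hRK₁` at every carrier = ★ p862409 §3), then as edition 15 (faces ★ p862134 →
★ p861474, middle ★ p861968, KIND W ★ p862137, `P = {½}`) into ★ ed. 3b.  THEN socket #41's `∃ P Es, …`.
[cite: Tan1999, §1 Main Theorem; §4 Props. 4.1, 4.4, 4.8] [cite: MoeglinWaldspurger1995, I.2.6, II.1.7, IV.1.8–IV.1.11] [cite: KudlaRallis1994, §1–§2] [cite: Shimura1997, §18.4, Prop. 18.14]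
[cite: Liu2021, Lem. B.10 (2), B.12] -/
theorem siegelEisensteinContinuation_sixteen
    (L : Type) [Field L] [NumberField L] [IsCMField L] {n : ℕ} (e : Fin 2 × Fin 1 ≃ Fin n)
    (dV : Fin 2 → L) (hdV : ∀ i, IsCMField.complexConj L (dV i) = dV i) (hdV0 : ∀ i, dV i ≠ 0)
    (dW : Fin 1 → L) (hdW : ∀ i, IsCMField.complexConj L (dW i) = dW i) (hdW0 : ∀ i, dW i ≠ 0)
    (lam : IdeleClassGroup L →ₜ* Circle) (hlam : IsConjugateSymplectic L lam) (hw : HasWeight L lam 1)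
    (𝒦 : IwasawaDatum L e dV hdV dW hdW) (h𝒦 : 𝒦.IsStd) (f : ℂ → HA L e dV hdV dW hdW → ℂ)
    (hstd : IsStandardSectionFamily 𝒦 (toHeckeCharacter L lam⁻¹) f) (hcont : ∀ s, Continuous (f s))
    -- the carrier (built by the tie as in ★ edition 2: Haar + ★ (C0) + ★ covering weight)
    [MeasurableSpace (unipDelta L e dV hdV dW hdW)] [BorelSpace (unipDelta L e dV hdV dW hdW)]
    (νN : Measure (unipDelta L e dV hdV dW hdW)) [νN.IsHaarMeasure]
    (β : unipDelta L e dV hdV dW hdW → ℝ≥0∞) (hβ : IsCoveringWeight (unipDeltaRat L e dV hdV dW hdW) β)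
    (hβ0 : ∫⁻ u, β u ∂νN ≠ 0) (hβtop : ∫⁻ u, β u ∂νN ≠ ∞)
    {K : Set (unipDelta L e dV hdV dW hdW)} (hK : IsCompact K) (hβK : ∀ u, β u ≤ K.indicator 1 u)
    -- KIND 0: rational Weyl presentation; big cell = ★ p861474's continuation letters `(S, hS, hur, E, hEd, hEeq)`; middle package
    (wq : unipDeltaRat L e dV hdV dW hdW → ratH L e dV hdV dW hdW)
    (hwq : ∀ ν, ((wq ν : ratH L e dV hdV dW hdW) : HA L e dV hdV dW hdW) = weylDelta L e dV hdV dW hdW * ((ν : unipDelta L e dV hdV dW hdW) : HA L e dV hdV dW hdW))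
    {S : Set (HeightOneSpectrum (𝓞 ↥(maximalRealSubfield L)))} (hS : S.Finite) (hur : ∀ v ∉ S, (quadraticHeckeCharCM L).IsUnramifiedAt v)
    -- KIND 0 big cell: ★ p862134 (K2Liu-p13) SUMMED FACES BY VALUE, per `κ ∈ K`: exceptional places `P₈ κ` off `S`, pure-tensor index `I₈ κ`, bad-place index `TF κ` with residue
    -- sizes `q`, the arch∕good blocks `A₈ κ i` (holomorphic), per-place letters `c₈ κ v` (holomorphic) and `N₈ κ i v` (q-rationally regular), the EULER-FACE IDENTITY `hB` (a SUM of pure tensors)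
    (P₈ : ↥𝒦.K → Finset (HeightOneSpectrum (𝓞 ↥(maximalRealSubfield L)))) (hPS : ∀ κ, ∀ v ∈ P₈ κ, v ∉ S)
    {ι₈ ι₈' : Type*} (I₈ : ↥𝒦.K → Finset ι₈') (TF : ↥𝒦.K → Finset ι₈) (q : ι₈ → ℕ) (hq : ∀ κ, ∀ v ∈ TF κ, q v ≠ 0)
    (A₈ : ↥𝒦.K → ι₈' → ℂ → ℂ) (hA₈ : ∀ κ, ∀ i ∈ I₈ κ, DifferentiableOn ℂ (A₈ κ i) {s : ℂ | 0 < s.re})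
    (c₈ : ↥𝒦.K → ι₈ → ℂ → ℂ) (hc₈ : ∀ κ, ∀ v ∈ TF κ, DifferentiableOn ℂ (c₈ κ v) {s : ℂ | 0 < s.re})
    (N₈ : ↥𝒦.K → ι₈' → ι₈ → ℂ → ℂ) (hN₈ : ∀ κ, ∀ i ∈ I₈ κ, ∀ v ∈ TF κ, ∀ s₀ : ℂ, 0 < s₀.re → IsQRationalRegularAt (q v) s₀ (N₈ κ i v))
    (hB : ∀ (κ : ↥𝒦.K) (s : ℂ), 1 < s.re →
      (partialStandardL (S ∪ (↑(P₈ κ) : Set (HeightOneSpectrum (𝓞 ↥(maximalRealSubfield L))))) (fun _ => {1}) (2 * s + 1) *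
            partialStandardL (S ∪ (↑(P₈ κ) : Set (HeightOneSpectrum (𝓞 ↥(maximalRealSubfield L))))) (fun v => {(quadraticHeckeCharCM L).valueAtUniformizer v}) (2 * s + 2)) /
          (partialStandardL (S ∪ (↑(P₈ κ) : Set (HeightOneSpectrum (𝓞 ↥(maximalRealSubfield L))))) (fun _ => {1}) (2 * s) *
            partialStandardL (S ∪ (↑(P₈ κ) : Set (HeightOneSpectrum (𝓞 ↥(maximalRealSubfield L))))) (fun v => {(quadraticHeckeCharCM L).valueAtUniformizer v}) (2 * s - 1)) *
        intertwiningDelta L e dV hdV dW hdW νN (f s) (κ : HA L e dV hdV dW hdW) = ∑ i ∈ I₈ κ, A₈ κ i s * ∏ v ∈ TF κ, (c₈ κ v s * N₈ κ i v s))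
    -- KIND 0 middle term: ★ p861968 (K2E4-p11) I4 ED. 2 letters BY VALUE — level data, the K-type package `W`, the inner family `φ`, Levi map `mx`, line representatives `γ₇`,
    -- the identification `hMID` of the un-normalised middle term
    (S₇ : Finset (HeightOneSpectrum (𝓞 L))) (γl : ∀ v : HeightOneSpectrum (𝓞 L), ValuativeRel.ValueGroupWithZero (v.adicCompletion L))
    (hγ0 : ∀ v ∈ S₇, γl v ≠ 0) (hγ1 : ∀ v ∈ S₇, γl v < 1)
    (W : Submodule ℂ (↥(standardMaximalCompactGL 2 L) → ℂ)) [FiniteDimensional ℂ W]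
    (hWstab : ∀ B ∈ W, ∀ k₀ : ↥(standardMaximalCompactGL 2 L), (fun k => B (k * k₀)) ∈ W)
    (hWlaw : ∀ B ∈ W, ∀ p k : ↥(standardMaximalCompactGL 2 L),
    ((p : GL (Fin 2) (AdeleRing (𝓞 L) L)) : Matrix (Fin 2) (Fin 2) (AdeleRing (𝓞 L) L)) 1 0 = 0 → B (p * k) = B k)
    (hWlev : ∀ B ∈ W, ∀ (k : ↥(standardMaximalCompactGL 2 L)) (r : GL (Fin 2) (FiniteAdeleRing (𝓞 L) L)) (hr : r ∈ glFiniteIntegralLevel 2 L),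
    (∀ v ∈ S₇, GLn.evalAt 2 L v r ∈ congruenceGL 2 (γl v)) →
      B ⟨(k : GL (Fin 2) (AdeleRing (𝓞 L) L)) * GLn.ofFinite 2 L r, (standardMaximalCompactGL 2 L).mul_mem k.2 (ofFinite_mem hr)⟩ = B k)
    (hWcont : ∀ B ∈ W, Continuous B)
    (hWext : ∀ B ∈ W, ∃ bB : ℂ → GL (Fin 2) (AdeleRing (𝓞 L) L) → ℂ,
    (∀ s : ℂ, 0 < s.re → ∀ (d : Fin 2 → (AdeleRing (𝓞 L) L)ˣ) (g : GL (Fin 2) (AdeleRing (𝓞 L) L)),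
      bB s (glDiagonal 2 (AdeleRing (𝓞 L) L) d * g) =
        ((IdeleClassGroup.ideleNorm L (d 0) : ℝ) : ℂ) ^ (s + 1 / 2) * ((IdeleClassGroup.ideleNorm L (d 1) : ℝ) : ℂ) ^ (-(s + 1 / 2)) * bB s g) ∧
    (∀ s : ℂ, 0 < s.re → ∀ u g : GL (Fin 2) (AdeleRing (𝓞 L) L), (u : Matrix (Fin 2) (Fin 2) (AdeleRing (𝓞 L) L)) 1 0 = 0 →
      (u : Matrix (Fin 2) (Fin 2) (AdeleRing (𝓞 L) L)) 0 0 = 1 → (u : Matrix (Fin 2) (Fin 2) (AdeleRing (𝓞 L) L)) 1 1 = 1 → bB s (u * g) = bB s g) ∧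
    (∀ s : ℂ, 0 < s.re → ∀ (k : GL (Fin 2) (AdeleRing (𝓞 L) L)) (hk : k ∈ standardMaximalCompactGL 2 L), bB s k = B ⟨k, hk⟩))
    (φ : ℂ → HA L e dV hdV dW hdW → GL (Fin 2) (AdeleRing (𝓞 L) L) → ℂ)
    (hφT : ∀ (s : ℂ) (x : HA L e dV hdV dW hdW), 0 < s.re → ∀ (d : Fin 2 → (AdeleRing (𝓞 L) L)ˣ) (g : GL (Fin 2) (AdeleRing (𝓞 L) L)),
    φ s x (glDiagonal 2 (AdeleRing (𝓞 L) L) d * g) =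
      ((IdeleClassGroup.ideleNorm L (d 0) : ℝ) : ℂ) ^ (s + 1 / 2) * ((IdeleClassGroup.ideleNorm L (d 1) : ℝ) : ℂ) ^ (-(s + 1 / 2)) * φ s x g)
    (hφN : ∀ (s : ℂ) (x : HA L e dV hdV dW hdW), 0 < s.re → ∀ u g : GL (Fin 2) (AdeleRing (𝓞 L) L), (u : Matrix (Fin 2) (Fin 2) (AdeleRing (𝓞 L) L)) 1 0 = 0 →
    (u : Matrix (Fin 2) (Fin 2) (AdeleRing (𝓞 L) L)) 0 0 = 1 → (u : Matrix (Fin 2) (Fin 2) (AdeleRing (𝓞 L) L)) 1 1 = 1 → φ s x (u * g) = φ s x g)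
    (hφW : ∀ (s : ℂ) (x : HA L e dV hdV dW hdW), 0 < s.re → (fun k : ↥(standardMaximalCompactGL 2 L) => φ s x k) ∈ W)
    (hφhol : ∀ (x : HA L e dV hdV dW hdW) (k : ↥(standardMaximalCompactGL 2 L)), DifferentiableOn ℂ (fun s => φ s x k) {s : ℂ | 0 < s.re})
    (hφbd : ∀ z : ℂ, 0 < z.re → ∃ C A r : ℝ, 0 ≤ C ∧ 0 ≤ A ∧ 0 < r ∧ ∀ s : ℂ, dist s z < r →
    ∀ (x : HA L e dV hdV dW hdW) (k : ↥(standardMaximalCompactGL 2 L)), ‖φ s x k‖ ≤ C * adelicHeightGL (n + n) L (x : GL (Fin (n + n)) (AdeleRing (𝓞 L) L)) ^ A)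
    (mx : HA L e dV hdV dW hdW → GL (Fin 2) (AdeleRing (𝓞 L) L)) {C₀ A₀ : ℝ} (hC₀ : 0 ≤ C₀) (hA₀ : 0 ≤ A₀)
    (hmx : ∀ x : HA L e dV hdV dW hdW, adelicHeightGL 2 L (mx x) ≤ C₀ * adelicHeightGL (n + n) L (x : GL (Fin (n + n)) (AdeleRing (𝓞 L) L)) ^ A₀)
    (γ₇ : Projectivization L (Fin 2 → L) → GL (Fin 2) L)
    (hγ : ∀ p, ∃ cL : L, cL ≠ 0 ∧ (Pi.single 1 1 : Fin 2 → L) ᵥ* (γ₇ p : Matrix (Fin 2) (Fin 2) L) = cL • p.rep)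
    (c₀ : ℂ)
    (hMID : ∀ (s : ℂ) (h : HA L e dV hdV dW hdW), (n : ℝ) / 2 < s.re →
      (∫ u, (β u).toReal •
        (∑' q : ↥(({Quotient.mk (MulAction.orbitRel (siegelDeltaRat L e dV hdV dW hdW) (ratH L e dV hdV dW hdW)) 1} ∪
            Set.range (fun ν : unipDeltaRat L e dV hdV dW hdW =>
              (Quotient.mk (MulAction.orbitRel (siegelDeltaRat L e dV hdV dW hdW) (ratH L e dV hdV dW hdW)) (wq ν) :
                SiegelDeltaQuot L e dV hdV dW hdW)))ᶜ : Set (SiegelDeltaQuot L e dV hdV dW hdW)),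
          f s ((((Quotient.out (q : SiegelDeltaQuot L e dV hdV dW hdW) : ratH L e dV hdV dW hdW) : HA L e dV hdV dW hdW)) *
            ((u : HA L e dV hdV dW hdW) * h))) ∂νN) =
        c₀ * ∑' p : Projectivization L (Fin 2 → L), φ s h (Matrix.GeneralLinearGroup.map (algebraMap L (AdeleRing (𝓞 L) L)) (γ₇ p) * mx h))
    -- KIND 1: THE LETTERS OF RECORD (★ p862409: `ι := Unit`, `a := 1`, `ρb := 1`, `ρa S s := (s − ½)⁻¹`, `G := 1`) — two ONE-FUNCTION packages, each: the function, its holomorphy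
    -- on `{0 < re}`, its PIN at THIS carrier `(νN, β)` on `{n∕2 < re s}` for rank-one `S`, (L-dec) height-form Gaussian decay in its own size `τ ≥ ‖S‖_∞`, (L-supp) support
    -- K1-b♮: the continued NORMALISED MIDDLE-CELL (line) term `Ebc` (`MID_S` with O41.4's rational Weyl presentation `wq`)
    (Ebc : skewMatrices ((IsCMField.complexConj L : L ≃ₐ[Fp L] L) : L →+* L) ((gramR L e dV hdV dW hdW).map (algebraMap (Fp L) L)) → ℂ → HA L e dV hdV dW hdW → ℂ)
    (hEbd : ∀ S x, DifferentiableOn ℂ (fun s => Ebc S s x) {s : ℂ | 0 < s.re})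
    (hEbc : ∀ S : skewMatrices ((IsCMField.complexConj L : L ≃ₐ[Fp L] L) : L →+* L) ((gramR L e dV hdV dW hdW).map (algebraMap (Fp L) L)),
      (S : Matrix (Fin n) (Fin n) L) ≠ 0 → (S : Matrix (Fin n) (Fin n) L).det = 0 → ∀ (s : ℂ) (h : HA L e dV hdV dW hdW), (n : ℝ) / 2 < s.re →
        ((∫⁻ u, β u ∂νN).toReal⁻¹ : ℝ) •
          (∫ u, (β u).toReal • (conj (unipDeltaChar L e dV hdV dW hdW (S : Matrix (Fin n) (Fin n) L) (u : HA L e dV hdV dW hdW) : ℂ) *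
            (∑' q : ↥(({Quotient.mk (MulAction.orbitRel (siegelDeltaRat L e dV hdV dW hdW) (ratH L e dV hdV dW hdW)) 1} ∪
              Set.range (fun ν : unipDeltaRat L e dV hdV dW hdW =>
                (Quotient.mk (MulAction.orbitRel (siegelDeltaRat L e dV hdV dW hdW) (ratH L e dV hdV dW hdW)) (wq ν) :
                  SiegelDeltaQuot L e dV hdV dW hdW)))ᶜ : Set (SiegelDeltaQuot L e dV hdV dW hdW)),
              f s ((((Quotient.out (q : SiegelDeltaQuot L e dV hdV dW hdW) : ratH L e dV hdV dW hdW) : HA L e dV hdV dW hdW)) *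
                ((u : HA L e dV hdV dW hdW) * h)))) ∂νN) = Ebc S s h)
    (τb : skewMatrices ((IsCMField.complexConj L : L ≃ₐ[Fp L] L) : L →+* L) ((gramR L e dV hdV dW hdW).map (algebraMap (Fp L) L)) → ℝ)
    (hτb : ∀ S : skewMatrices ((IsCMField.complexConj L : L ≃ₐ[Fp L] L) : L →+* L) ((gramR L e dV hdV dW hdW).map (algebraMap (Fp L) L)),
      ‖(fun i j => NumberField.mixedEmbedding L ((S : Matrix (Fin n) (Fin n) L) i j))‖ ≤ τb S) (Nb : ℕ)
    (hdecb : ∀ z : ℂ, 0 < z.re → ∃ C a c a' r : ℝ, 0 ≤ C ∧ 0 ≤ a ∧ 0 < c ∧ 0 ≤ a' ∧ 0 < r ∧ ∀ S (s : ℂ), dist s z < r → ∀ h : HA L e dV hdV dW hdW,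
      ‖Ebc S s h‖ ≤ C * adelicHeightGL (n + n) L (h : GL (Fin (n + n)) (AdeleRing (𝓞 L) L)) ^ a *
        (Real.exp (-(c * adelicHeightGL (n + n) L (h : GL (Fin (n + n)) (AdeleRing (𝓞 L) L)) ^ (-a') * τb S)) * (1 + τb S) ^ Nb))
    {Cb κb : ℝ} (hCb : 0 < Cb) (hκb : 0 ≤ κb)
    (hsuppb : ∀ S (s : ℂ) (h : HA L e dV hdV dW hdW), 0 < s.re → Ebc S s h ≠ 0 →
      ∃ D : ℕ, 1 ≤ D ∧ (D : ℝ) ≤ Cb * adelicHeightGL (n + n) L (h : GL (Fin (n + n)) (AdeleRing (𝓞 L) L)) ^ κb ∧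
        ∀ i j, IsIntegral ℤ ((D : L) * (S : Matrix (Fin n) (Fin n) L) i j))
    -- K1-a♮: the continued `(s − ½)·`NORMALISED WHITTAKER (singular) term `Eac`
    (Eac : skewMatrices ((IsCMField.complexConj L : L ≃ₐ[Fp L] L) : L →+* L) ((gramR L e dV hdV dW hdW).map (algebraMap (Fp L) L)) → ℂ → HA L e dV hdV dW hdW → ℂ)
    (hEad : ∀ S x, DifferentiableOn ℂ (fun s => Eac S s x) {s : ℂ | 0 < s.re})
    (hEac : ∀ S : skewMatrices ((IsCMField.complexConj L : L ≃ₐ[Fp L] L) : L →+* L) ((gramR L e dV hdV dW hdW).map (algebraMap (Fp L) L)),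
      (S : Matrix (Fin n) (Fin n) L) ≠ 0 → (S : Matrix (Fin n) (Fin n) L).det = 0 → ∀ (s : ℂ) (h : HA L e dV hdV dW hdW), (n : ℝ) / 2 < s.re →
        (s - 1 / 2) * (((∫⁻ u, β u ∂νN).toReal⁻¹ : ℝ) • whittakerDelta L e dV hdV dW hdW νN (S : Matrix (Fin n) (Fin n) L) (f s) h) = Eac S s h)
    (τa : skewMatrices ((IsCMField.complexConj L : L ≃ₐ[Fp L] L) : L →+* L) ((gramR L e dV hdV dW hdW).map (algebraMap (Fp L) L)) → ℝ)
    (hτa : ∀ S : skewMatrices ((IsCMField.complexConj L : L ≃ₐ[Fp L] L) : L →+* L) ((gramR L e dV hdV dW hdW).map (algebraMap (Fp L) L)),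
      ‖(fun i j => NumberField.mixedEmbedding L ((S : Matrix (Fin n) (Fin n) L) i j))‖ ≤ τa S) (Na : ℕ)
    (hdeca : ∀ z : ℂ, 0 < z.re → ∃ C a c a' r : ℝ, 0 ≤ C ∧ 0 ≤ a ∧ 0 < c ∧ 0 ≤ a' ∧ 0 < r ∧ ∀ S (s : ℂ), dist s z < r → ∀ h : HA L e dV hdV dW hdW,
      ‖Eac S s h‖ ≤ C * adelicHeightGL (n + n) L (h : GL (Fin (n + n)) (AdeleRing (𝓞 L) L)) ^ a *
        (Real.exp (-(c * adelicHeightGL (n + n) L (h : GL (Fin (n + n)) (AdeleRing (𝓞 L) L)) ^ (-a') * τa S)) * (1 + τa S) ^ Na))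
    {Ca κa : ℝ} (hCa : 0 < Ca) (hκa : 0 ≤ κa)
    (hsuppa : ∀ S (s : ℂ) (h : HA L e dV hdV dW hdW), 0 < s.re → Eac S s h ≠ 0 →
      ∃ D : ℕ, 1 ≤ D ∧ (D : ℝ) ≤ Ca * adelicHeightGL (n + n) L (h : GL (Fin (n + n)) (AdeleRing (𝓞 L) L)) ^ κa ∧
        ∀ i j, IsIntegral ℤ ((D : L) * (S : Matrix (Fin n) (Fin n) L) i j))
    -- KIND W: ★ p862137 (F0P2-p08 ∘ K2E4-p10) letters BY VALUE — Euler data `(A, U, hEuler)` at the Whittaker level, holomorphy `hAd`, and the three (W3) letters on `A`: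
    -- archimedean size `τ` with `hτ`, height-form Gaussian decay `hdec`, bounded-denominator support `hsupp`
    -- (W1) the EULER DATA by value: `T`-part `A` and exceptional place set `U(S,h) = D(S) ∪ T(S,h)`, with the Euler identity on `{n∕2 < re s}`
    (A : skewMatrices ((IsCMField.complexConj L : L ≃ₐ[Fp L] L) : L →+* L) ((gramR L e dV hdV dW hdW).map (algebraMap (Fp L) L)) → ℂ → HA L e dV hdV dW hdW → ℂ)
    (U : skewMatrices ((IsCMField.complexConj L : L ≃ₐ[Fp L] L) : L →+* L) ((gramR L e dV hdV dW hdW).map (algebraMap (Fp L) L)) → HA L e dV hdV dW hdW →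
      Set (HeightOneSpectrum (𝓞 ↥(maximalRealSubfield L))))
    (hEuler : ∀ S : skewMatrices ((IsCMField.complexConj L : L ≃ₐ[Fp L] L) : L →+* L) ((gramR L e dV hdV dW hdW).map (algebraMap (Fp L) L)),
      (S : Matrix (Fin n) (Fin n) L).det ≠ 0 → ∀ (s : ℂ) (h : HA L e dV hdV dW hdW), (n : ℝ) / 2 < s.re →
        whittakerDelta L e dV hdV dW hdW νN (S : Matrix (Fin n) (Fin n) L) (f s) h =
          A S s h * (partialStandardL (U S h) (fun _ => {1}) (2 * s + 1) *
            partialStandardL (U S h) (fun v => {(quadraticHeckeCharCM L).valueAtUniformizer v}) (2 * s + 2))⁻¹)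
    -- (W2) holomorphy of the `T`-part
    (hAd : ∀ S (h : HA L e dV hdV dW hdW), DifferentiableOn ℂ (fun s => A S s h) {s : ℂ | 0 < s.re})
    -- (W3) K2E4-p10 (g8)'s three letters on `A`
    (τ : skewMatrices ((IsCMField.complexConj L : L ≃ₐ[Fp L] L) : L →+* L) ((gramR L e dV hdV dW hdW).map (algebraMap (Fp L) L)) → ℝ)
    (hτ : ∀ S : skewMatrices ((IsCMField.complexConj L : L ≃ₐ[Fp L] L) : L →+* L) ((gramR L e dV hdV dW hdW).map (algebraMap (Fp L) L)),
      ‖(fun i j => NumberField.mixedEmbedding L ((S : Matrix (Fin n) (Fin n) L) i j))‖ ≤ τ S) (NW : ℕ)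
    (hdec : ∀ z : ℂ, 0 < z.re → ∃ C a c a' r : ℝ, 0 ≤ C ∧ 0 ≤ a ∧ 0 < c ∧ 0 ≤ a' ∧ 0 < r ∧ ∀ S (s : ℂ), dist s z < r → ∀ h : HA L e dV hdV dW hdW,
      ‖A S s h‖ ≤ C * adelicHeightGL (n + n) L (h : GL (Fin (n + n)) (AdeleRing (𝓞 L) L)) ^ a *
        (Real.exp (-(c * adelicHeightGL (n + n) L (h : GL (Fin (n + n)) (AdeleRing (𝓞 L) L)) ^ (-a') * τ S)) * (1 + τ S) ^ NW))
    {CW κ : ℝ} (hCW : 0 < CW) (hκ : 0 ≤ κ)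
    (hsupp : ∀ S (s : ℂ) (h : HA L e dV hdV dW hdW), 0 < s.re → A S s h ≠ 0 →
      ∃ D : ℕ, 1 ≤ D ∧ (D : ℝ) ≤ CW * adelicHeightGL (n + n) L (h : GL (Fin (n + n)) (AdeleRing (𝓞 L) L)) ^ κ ∧
        ∀ i j, IsIntegral ℤ ((D : L) * (S : Matrix (Fin n) (Fin n) L) i j)) :
    ∃ (P : Finset ℂ) (Es : ℂ → HA L e dV hdV dW hdW → ℂ),
      (∀ h : HA L e dV hdV dW hdW, DifferentiableOn ℂ (fun s => Es s h) {s : ℂ | 0 < s.re}) ∧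
      (∀ s : ℂ, 0 < s.re → Continuous (Es s)) ∧
      (∀ s : ℂ, 0 < s.re → ∀ (γ : ratH L e dV hdV dW hdW) (h : HA L e dV hdV dW hdW),
        Es s ((γ : HA L e dV hdV dW hdW) * h) = Es s h) ∧
      (∀ (s : ℂ) (h : HA L e dV hdV dW hdW), (n : ℝ) / 2 < s.re →
        Es s h = (∏ p ∈ P, (s - p)) * eisensteinFamilyDelta L e dV hdV dW hdW f s h) ∧
      (∀ z : ℂ, 0 < z.re → ∃ C A r : ℝ, 0 < r ∧ ∀ s : ℂ, dist s z < r → ∀ h : HA L e dV hdV dW hdW,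
        ‖Es s h‖ ≤ C * adelicHeightGL (n + n) L (h : GL (Fin (n + n)) (AdeleRing (𝓞 L) L)) ^ A) := by
  have hn : 0 < n := by
    have h2 : Fintype.card (Fin 2 × Fin 1) = Fintype.card (Fin n) := Fintype.card_congr e
    simp only [Fintype.card_prod, Fintype.card_fin] at h2
    omega
  haveI : NeZero n := ⟨hn.ne'⟩
  have hχ : (toHeckeCharacter L lam⁻¹).IsUnitary := isUnitary_toHeckeCharacter L lam⁻¹
  -- KIND W: ★ p862052 factor letters (F0P2-p08), then the Whittaker level: `E_S = (∫β)⁻¹·W_S` (★ Φ2 under ★ ed. 4a′), `WT` rescaled by `c := (∫β)⁻¹`; ★ p861446, ★ p861512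
  obtain ⟨WT, GW, w, hWTd, hGWd, hw0, hws, hg, hRKW⟩ :=
    exists_whittaker_factorLetters_of_weightLetters L hn e dV hdV dW hdW f νN A U hEuler hAd τ hτ NW hdec hCW hκ hsupp
  set c : ℝ := (∫⁻ u, β u ∂νN).toReal⁻¹ with hc
  have hWTd' : ∀ S (h : HA L e dV hdV dW hdW), DifferentiableOn ℂ (fun s => (c : ℂ) * WT S s h) {s : ℂ | 0 < s.re} :=
    fun S h => (hWTd S h).const_mul _
  have hg' : ∀ z : ℂ, 0 < z.re → ∃ C A r : ℝ, 0 ≤ C ∧ 0 ≤ A ∧ 0 < r ∧ ∀ S (s : ℂ), dist s z < r → ∀ h : HA L e dV hdV dW hdW,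
      ‖(c : ℂ) * WT S s h * GW S s h‖ ≤ C * w S * adelicHeightGL (n + n) L (h : GL (Fin (n + n)) (AdeleRing (𝓞 L) L)) ^ A := by
    intro z hz
    obtain ⟨C, A, r, hC, hA, hr, hb⟩ := hg z hz
    refine ⟨|c| * C, A, r, by positivity, hA, hr, fun S s hs h => ?_⟩
    calc ‖(c : ℂ) * WT S s h * GW S s h‖ = |c| * ‖WT S s h * GW S s h‖ := by
          rw [mul_assoc, norm_mul, Complex.norm_real, Real.norm_eq_abs]
      _ ≤ |c| * (C * w S * adelicHeightGL (n + n) L (h : GL (Fin (n + n)) (AdeleRing (𝓞 L) L)) ^ A) :=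
          mul_le_mul_of_nonneg_left (hb S s hs h) (abs_nonneg c)
      _ = |c| * C * w S * adelicHeightGL (n + n) L (h : GL (Fin (n + n)) (AdeleRing (𝓞 L) L)) ^ A := by ring
  have hRK : ∀ S : skewMatrices ((IsCMField.complexConj L : L ≃ₐ[Fp L] L) : L →+* L) ((gramR L e dV hdV dW hdW).map (algebraMap (Fp L) L)),
      (S : Matrix (Fin n) (Fin n) L).det ≠ 0 → ∀ (s : ℂ) (h : HA L e dV hdV dW hdW), (n : ℝ) / 2 < s.re →
        fourierCoeffDelta L e dV hdV dW hdW νN β (S : Matrix (Fin n) (Fin n) L) (eisensteinFamilyDelta L e dV hdV dW hdW f s) h =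
          (c : ℂ) * WT S s h * GW S s h := by
    intro S hdet s h hs
    rw [fourierCoeffDelta_eisensteinFamilyDelta_eq_curve e dV hdV hdV0 dW hdW hdW0 𝒦 hstd hcont wq hwq νN hβ s h
      (lintegral_tsum_enorm_mul_weight_ne_top L e dV hdV dW hdW hdV0 hdW0 hχ hs (hstd.1.1 s) (hcont s) νN hβtop hK hβK h) S.2 hdet,
      hRKW S hdet s h hs, Complex.real_smul, hc, mul_assoc]
  obtain ⟨EcW, hWoff, hWd, hWc, hWcoef, hWg⟩ := exists_whittaker_packages_fourierCoeff_fixedCarrier L hn e dV hdV dW hdW νN β f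
    (fun S s h => (c : ℂ) * WT S s h) GW hWTd' hGWd w hw0 hg'
    (fun S _ s hs => continuous_fourierCoeffDelta_eisensteinSeriesDelta L e dV hdV dW hdW hdV0 hdW0 νN hβ (S : Matrix (Fin n) (Fin n) L) hχ hs
      (hstd.1.1 s) (hcont s)) hRK ({(1 / 2 : ℂ)} : Finset ℂ)
  -- KIND 1 at the letters of record: the summable weights from (L-dec) + (L-supp) (★ p862451, once per term), then ★ p862409 §4 at THIS carrier (`hRK₁` at every carrier inside,
  -- `hRKc` ★ p861715 inside ★ p861869)
  obtain ⟨ub, hub, hubs, hbg⟩ := kindOne_weight_of_decay L hn e dV hdV dW hdW Ebc τb hτb Nb hdecb hCb hκb hsuppb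
  obtain ⟨uG, huG, huGs, haG⟩ := kindOne_weight_of_decay L hn e dV hdV dW hdW Eac τa hτa Na hdeca hCa hκa hsuppa
  obtain ⟨Ec₁, h1off, hd₁, hc₁, hcoef₁, hmaj₁, hgr₁⟩ := exists_kindOne_sixLetters_of_record L e dV hdV dW hdW hdV0 hdW0 hn hχ f hstd.1.1 hcont
    ({(1 / 2 : ℂ)} : Finset ℂ) (Finset.mem_singleton_self _) wq hwq νN hβ hβtop hK hβK Ebc hEbd Eac hEad ub uG hub huG hbg haG (hubs.add huGs) hEbc hEac
  -- KIND 0: big cell (★ p861499 over ★ p861423), middle (rescaled), identity (★ `standardFamily_growth`), O41.4 finiteness (★ ed. 4a′), assembly (★ ed. 4a)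
  have hn2 : n = 2 := by
    have h2 : Fintype.card (Fin 2 × Fin 1) = Fintype.card (Fin n) := Fintype.card_congr e
    simp only [Fintype.card_prod, Fintype.card_fin] at h2
    omega
  -- KIND 0 middle term: ★ p861968 (I4 instance, ED. 2)
  obtain ⟨E₇, h7d, h7c, h7eq, h7g⟩ := exists_middleTerm_package' L e dV hdV dW hdW hn2 hdV0 hdW0 S₇ γl hγ0 hγ1 W hWstab hWlaw hWlev hWcont hWext
    φ hφT hφN hφW hφhol hφbd mx hC₀ hA₀ hmx γ₇ hγ νN β wq hχ f hstd.1.1 hcont hβ.measurable hK hβK c₀ hMID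
  -- KIND 0 big cell continuation: ★ p862134 (summed faces → `(E, hEd, hEeq)`)
  obtain ⟨E, hEd, hEeq⟩ := exists_bigCell_continuation_cm_of_facesSum L e dV hdV dW hdW hn2 hdV0 hdW0 𝒦 νN (toHeckeCharacter L lam⁻¹) hstd S P₈ hPS I₈ TF q hq
    A₈ hA₈ c₈ hc₈ N₈ hN₈ hB
  obtain ⟨Ec₈, h8d, h8c, h8eq, h8g⟩ :=
    exists_bigCell_termPackage_cm L e dV hdV dW hdW hn2 hdV0 hdW0 𝒦 νN (toHeckeCharacter L lam⁻¹) hχ f hstd hcont hS hur E hEd hEeq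
  obtain ⟨h8d', h8c', h8eq', h8g'⟩ := smul_package (fun h : HA L e dV hdV dW hdW => adelicHeightGL (n + n) L (h : GL (Fin (n + n)) (AdeleRing (𝓞 L) L)))
    ((∫⁻ u, β u ∂νN).toReal⁻¹) ({(1 / 2 : ℂ)} : Finset ℂ) _ Ec₈ h8d h8c h8eq h8g
  obtain ⟨h7d', h7c', h7eq', h7g'⟩ := smul_package (fun h : HA L e dV hdV dW hdW => adelicHeightGL (n + n) L (h : GL (Fin (n + n)) (AdeleRing (𝓞 L) L)))
    ((∫⁻ u, β u ∂νN).toReal⁻¹) ({(1 / 2 : ℂ)} : Finset ℂ) _ E₇ h7d h7c h7eq h7g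
  obtain ⟨Ec₀, hd₀, hc₀, hcoef₀, hbd₀, hgr₀⟩ := exists_constantTerm_package L e dV hdV dW hdW hn νN hβ hβ0 hβtop wq hwq f hstd.1.1 hcont
    (fun h => (hstd.1.2 h).differentiableOn) (standardFamily_growth L e dV hdV dW hdW 𝒦 hχ f hstd hcont)
    (fun s h hs => lintegral_tsum_enorm_mul_weight_ne_top L e dV hdV dW hdW hdV0 hdW0 hχ hs (hstd.1.1 s) (hcont s) νN hβtop hK hβK h)
    ({(1 / 2 : ℂ)} : Finset ℂ) (fun s h => (∫⁻ u, β u ∂νN).toReal⁻¹ • Ec₈ s h) h8d' h8c' h8eq' h8g' (fun s h => (∫⁻ u, β u ∂νN).toReal⁻¹ • E₇ s h) h7d' h7c' h7eq' h7g'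
  -- ★ edition 3b at `P := {½}`
  exact siegelEisensteinContinuation_of_kinds_fixedCarrier L e dV hdV hdV0 dW hdW hdW0 lam hlam hw 𝒦 h𝒦 f hstd hcont νN β hβ hβ0 hβtop ({(1 / 2 : ℂ)} : Finset ℂ)
    Ec₀ hd₀ hc₀ hcoef₀ hbd₀ hgr₀ Ec₁ h1off hd₁ hc₁ (hcoef₁ νN β hβ hβ0 hβtop) hmaj₁ hgr₁
    EcW hWoff hWd hWc hWcoef
    (whittaker_majorant_of_weightedGrowth L hn e dV hdV dW hdW EcW w hw0 hws hWg) (whittaker_summedGrowth_of_weightedGrowth L e dV hdV dW hdW EcW w hws hWg)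

end Summit.HodgeConjecture.HodgeConjecture.Cruxes.HLiu418.K2LiuSiegelEisensteinContinuationTopSixteen

end
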